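import Mathlib
import Literature.Analysis.FluidPDE.PineauVicolEnstrophy
import Literature.Analysis.FluidPDE.AxisymHouLiVariables
import Literature.Analysis.FluidPDE.AxisymmetricLiftR5
import Literature.Analysis.FluidPDE.AxisymNoSwirlScaleInvariantBounds
import Literature.Analysis.FluidPDE.BiotSavartRepresentationSqIntegrable
import HarnessLib

/-!
# Hydrodynamic impulse of integrable velocity fields: the total velocity flux and the
# linear impulse of an integrable divergence-free field vanish

Saffman, *Vortex Dynamics* (CUP 1992), §3.2: for an unbounded incompressible flow at rest at infinity the
HYDRODYNAMIC IMPULSE is `I = ½ ∫ x × ω dx` ((3.2.8); Majda–Bertozzi (1.68)), and for every vector field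
`a` one has the identity `∫_V x × curl a dx = 2 ∫_V a dx + ∮ x × (n × a) dS` ((3.2.11)), whence the fluid
momentum in a volume is the impulse plus a surface term, `∫_V u = ½∫_V x × ω + ½∮[u (n·x) − n (u·x)] dS`
((3.2.13)), and `∫_V u = ∮ x (u·n) dS` for a divergence-free `u` ((3.2.15)). Saffman stresses that
`∫ u dx` over all space is in general only conditionally convergent (a dipole far field `u = O(|I|/r³)`);
this file records the ABSOLUTELY CONVERGENT case, i.e. what the identities say for INTEGRABLE fields,
where all surface terms die along `r → ∞`:

* `integral_inner_eq_zero_of_isDivFree_of_integrable`, `integral_eq_zero_of_isDivFree_of_integrable`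
  ((3.2.15) with `V → ℝⁿ`): a `C¹` divergence-free INTEGRABLE vector field on a finite-dimensional inner
  product space has ZERO TOTAL FLUX, `∫ V dx = 0` (Majda–Bertozzi (1.64) `V₃`; the remark behind the
  moment conditions of Dobrokhotov–Shafarevich / Brandolese–Meyer for Navier–Stokes slices).
* `integral_swirl_curl_eq_two_mul_integral` ((3.2.11), axial component, `a = v`): for `v ∈ C¹(ℝ³; ℝ³)` with
  `v` and `x ↦ (x × curl v)₃ = swirl (curl v) x` integrable, `∫ (x × curl v)₃ dx = 2 ∫ v₃ dx` — NO
  divergence condition; hence for divergence-free `v` the axial impulse vanishes,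
  `integral_swirl_curl_eq_zero_of_isDivFree` ((3.2.13) + (3.2.15)), and a SINGLE-SIGNED axial impulse
  density `(x × curl v)₃ ≥ 0` forces `(x × curl v)₃ ≡ 0` (`swirl_curl_eq_zero_of_nonneg`).
* Axisymmetric dictionary (`(x × ω)₃ = r ω_θ = r² · (ω_θ/r)`, tree
  `IsAxisymmetric.cylRadius_sq_mul_angVortQuot`): for an axisymmetric `C³` divergence-free integrable `v`
  with `r²·(ω_θ/r)` integrable and `ω_θ/r ≥ 0` everywhere, `ω_θ/r ≡ 0`
  (`IsAxisymmetric.angVortQuot_eq_zero_of_nonneg_of_integrable`): a single-signed swirl-free vortex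
  (Hill's vortex, vortex rings) carries the positive impulse `I₃ = ½∫ r²(ω_θ/r) > 0` and is therefore
  NEVER integrable — its far field is the `O(|I|/r³)` dipole of (3.2.7)–(3.2.8).

Method: both integral identities are instances of the tree's `∫ div F = 0` for `C¹` fields with
`div F ∈ L¹` and `‖F‖/(1+|x|) ∈ L¹` (`PineauVicol2026.integral_divergence_eq_zero_of_integrable_div`,
smooth cut-offs + dominated convergence), applied to `F = ⟪x, e⟫ V` (`div F = ⟪V, e⟫`) and to
`G = (x₀v₀ + x₁v₁) e₂ − x₀v₂ e₀ − x₁v₂ e₁` (`div G = (x × curl v)₃ − 2v₃`, the pointwise form of (3.2.11)).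
The other two components of (3.2.11) follow by permuting coordinates and are not spelled out. The DYNAMICS
of the impulse (`dI/dt = ∫ F dx` for a body force `F`, Saffman (3.2.9): conserved without force, CHANGED by
a force of non-zero mean) is not formalised here; it is the reason a forced Navier–Stokes slice need not be
integrable.

References: P. G. Saffman, *Vortex Dynamics*, Cambridge Univ. Press (1992), §3.2, eqs. (8), (9), (11),
(13), (15) [cite: Saffman1992, §3.2 (3.2.8)–(3.2.15)]; A. J. Majda, A. L. Bertozzi, *Vorticity and
Incompressible Flow* (2002), §1.7, Prop. 1.12, (1.64), (1.68) [cite: MajdaBertozziCUP2002, §1.7 Prop. 1.12].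
-/

noncomputable section

open MeasureTheory Filter Set Function
open scoped RealInnerProductSpace Topology

namespace Literature.Analysis.FluidPDE

/-! ### Zero total flux of an integrable divergence-free field (Saffman (3.2.15)) -/

section Flux

variable {E : Type*} [NormedAddCommGroup E] [InnerProductSpace ℝ E] [FiniteDimensional ℝ E]
  [MeasurableSpace E] [BorelSpace E]

/-- **Zero total flux, component form** (Saffman 1992, §3.2 (15): `∫_V u dV = ∮ x (u·n) dS` for
divergence-free `u`, and the surface term dies for an integrable field): for a `C¹` divergence-free
integrable vector field `V` on a finite-dimensional inner product space and every fixed vector `e`,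
`∫ ⟪e, V x⟫ dx = 0`. Proof: `F(x) = ⟪e, x⟫ V(x)` is `C¹` with `div F = ⟪e, V⟫ + ⟪e, x⟫ div V = ⟪e, V⟫`
integrable and `‖F(x)‖/(1 + ‖x‖) ≤ ‖e‖ ‖V(x)‖` integrable, so `∫ div F = 0`
(`PineauVicol2026.integral_divergence_eq_zero_of_integrable_div`). [cite: Saffman1992, §3.2 eq. (3.2.15)] -/
theorem integral_inner_eq_zero_of_isDivFree_of_integrable {V : E → E} (hV : ContDiff ℝ 1 V)
    (hdiv : VectorCalculus.IsDivFree V) (hint : Integrable V) (e : E) :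
    ∫ x, ⟪e, V x⟫ = 0 := by
  -- the weighted field `F x = ⟪e, x⟫ • V x`
  set θ : E → ℝ := fun x => ⟪e, x⟫ with hθ
  have hθ' : ∀ x, HasFDerivAt θ (innerSL ℝ e) x := fun x => (innerSL ℝ e).hasFDerivAt
  have hθd : ContDiff ℝ 1 θ := (innerSL ℝ e).contDiff
  set F : E → E := fun x => θ x • V x with hF
  have hF1 : ContDiff ℝ 1 F := hθd.smul hV
  -- its divergence is `⟪e, V⟫`
  have hdivF : ∀ x, VectorCalculus.divergence F x = ⟪e, V x⟫ := by
    intro x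
    have hVx : DifferentiableAt ℝ V x := (hV.differentiable one_ne_zero) x
    rw [hF, divergence_smul_apply (hθ' x).differentiableAt hVx, hdiv x, mul_zero, zero_add,
      real_inner_comm, gradient, InnerProductSpace.toDual_symm_apply, (hθ' x).fderiv, innerSL_apply_apply]
  have hdivF' : (fun x => VectorCalculus.divergence F x) = fun x => ⟪e, V x⟫ := funext hdivF
  -- integrability of `div F` and of `‖F‖/(1+‖x‖)`
  have hdI : Integrable fun x => VectorCalculus.divergence F x := by
    rw [hdivF']; exact hint.const_inner e
  have hwI : Integrable fun x => ‖F x‖ / (1 + ‖x‖) := by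
    refine (hint.norm.const_mul ‖e‖).mono' ?_ (Eventually.of_forall fun x => ?_)
    · exact ((hF1.continuous.norm).div (continuous_const.add continuous_norm)
        fun x => (by positivity : (1 : ℝ) + ‖x‖ ≠ 0)).aestronglyMeasurable
    · have h1 : 0 < 1 + ‖x‖ := by positivity
      rw [Real.norm_of_nonneg (by positivity), hF, norm_smul, div_le_iff₀ h1]
      calc ‖θ x‖ * ‖V x‖ ≤ (‖e‖ * ‖x‖) * ‖V x‖ := by
            gcongr; exact norm_inner_le_norm e x
        _ ≤ ‖e‖ * ‖V x‖ * (1 + ‖x‖) := by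
            nlinarith [norm_nonneg e, norm_nonneg x, norm_nonneg (V x),
              mul_nonneg (norm_nonneg e) (norm_nonneg (V x))]
  have h := PineauVicol2026.integral_divergence_eq_zero_of_integrable_div hF1 hwI hdI
  rwa [hdivF'] at h

/-- **ZERO TOTAL FLUX OF VELOCITY** (Saffman 1992, §3.2 (15); Majda–Bertozzi (1.64): the total flux
`V₃ = ∫ v dx`): a `C¹` divergence-free integrable vector field on a finite-dimensional inner product
space has `∫ V dx = 0`. (For a field that is merely `O(r⁻³)` the integral is conditionally convergent
and equals `⅔ I` over large spheres, Saffman (3.2.14); integrability kills the impulse.)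
[cite: Saffman1992, §3.2 eq. (3.2.15)] -/
theorem integral_eq_zero_of_isDivFree_of_integrable {V : E → E} (hV : ContDiff ℝ 1 V)
    (hdiv : VectorCalculus.IsDivFree V) (hint : Integrable V) : ∫ x, V x = 0 :=
  integral_eq_zero_of_forall_integral_inner_eq_zero (𝕜 := ℝ) V hint fun e =>
    integral_inner_eq_zero_of_isDivFree_of_integrable hV hdiv hint e

end Flux

/-! ### The axial impulse identity in `ℝ³` (Saffman (3.2.11), third component) -/

section Impulse

variable {v : (EuclideanSpace ℝ (Fin 3)) → (EuclideanSpace ℝ (Fin 3))}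

/-- The coordinate functions are the projections. [folklore] -/
private theorem hasFDerivAt_coord' (j : Fin 3) (x : (EuclideanSpace ℝ (Fin 3))) :
    HasFDerivAt (fun y : (EuclideanSpace ℝ (Fin 3)) => y j) (EuclideanSpace.proj j : (EuclideanSpace ℝ (Fin 3)) →L[ℝ] ℝ) x :=
  (EuclideanSpace.proj j : (EuclideanSpace ℝ (Fin 3)) →L[ℝ] ℝ).hasFDerivAt

/-- A coordinate of a differentiable field: `D(vᵢ)(x) = πᵢ ∘ Dv(x)`. [folklore] -/
private theorem hasFDerivAt_apply_coord' {x : (EuclideanSpace ℝ (Fin 3))} (hv : DifferentiableAt ℝ v x) (i : Fin 3) :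
    HasFDerivAt (fun y => v y i) ((EuclideanSpace.proj i : (EuclideanSpace ℝ (Fin 3)) →L[ℝ] ℝ).comp (fderiv ℝ v x)) x :=
  (EuclideanSpace.proj i : (EuclideanSpace ℝ (Fin 3)) →L[ℝ] ℝ).hasFDerivAt.comp x hv.hasFDerivAt

/-- **The pointwise form of Saffman's (3.2.11), third component.** For `v` differentiable at `x`,
the field `G(y) = (y₀v₀ + y₁v₁) e₂ − y₀v₂ e₀ − y₁v₂ e₁` has
`div G (x) = (x × curl v)₃ − 2 v₃ = swirl (curl v) x − 2 v x 2`
(`(x × ω)₃ = x₀ω₁ − x₁ω₀ = x₀(∂₂v₀ − ∂₀v₂) − x₁(∂₁v₂ − ∂₂v₁)`). [cite: Saffman1992, §3.2 eq. (3.2.11)] -/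
theorem divergence_axialImpulseFlux_eq {x : (EuclideanSpace ℝ (Fin 3))} (hv : DifferentiableAt ℝ v x) :
    VectorCalculus.divergence (fun y : (EuclideanSpace ℝ (Fin 3)) =>
        (y 0 * v y 0 + y 1 * v y 1) • (EuclideanSpace.single 2 (1 : ℝ) : (EuclideanSpace ℝ (Fin 3))) -
          (y 0 * v y 2) • (EuclideanSpace.single 0 (1 : ℝ) : (EuclideanSpace ℝ (Fin 3))) -
          (y 1 * v y 2) • (EuclideanSpace.single 1 (1 : ℝ) : (EuclideanSpace ℝ (Fin 3)))) x =
      swirl (curl v) x - 2 * v x 2 := by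
  have hc := hasFDerivAt_coord'
  have hvi := hasFDerivAt_apply_coord' hv
  have h2 : HasFDerivAt (fun y : (EuclideanSpace ℝ (Fin 3)) => y 0 * v y 0 + y 1 * v y 1) _ x :=
    ((hc 0 x).mul (hvi 0)).add ((hc 1 x).mul (hvi 1))
  have h0 : HasFDerivAt (fun y : (EuclideanSpace ℝ (Fin 3)) => y 0 * v y 2) _ x := (hc 0 x).mul (hvi 2)
  have h1 : HasFDerivAt (fun y : (EuclideanSpace ℝ (Fin 3)) => y 1 * v y 2) _ x := (hc 1 x).mul (hvi 2)
  have hG : HasFDerivAt (fun y : (EuclideanSpace ℝ (Fin 3)) =>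
      (y 0 * v y 0 + y 1 * v y 1) • (EuclideanSpace.single 2 (1 : ℝ) : (EuclideanSpace ℝ (Fin 3))) -
        (y 0 * v y 2) • (EuclideanSpace.single 0 (1 : ℝ) : (EuclideanSpace ℝ (Fin 3))) -
        (y 1 * v y 2) • (EuclideanSpace.single 1 (1 : ℝ) : (EuclideanSpace ℝ (Fin 3)))) _ x :=
    ((h2.smul_const _).sub (h0.smul_const _)).sub (h1.smul_const _)
  rw [divergence_eq_sum_inner_fderiv (EuclideanSpace.basisFun (Fin 3) ℝ), hG.fderiv]
  simp [EuclideanSpace.inner_single_right, inner_sub_right, inner_smul_right, swirl, FluidPDE.curl]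
  ring

/-- `|yᵢ| · |w y j| ≤ ‖y‖ ‖w y‖`-type bound: `‖(a) • e‖` bookkeeping for the flux field. [folklore] -/
private theorem norm_axialImpulseFlux_le (v : (EuclideanSpace ℝ (Fin 3)) → (EuclideanSpace ℝ (Fin 3))) (y : (EuclideanSpace ℝ (Fin 3))) :
    ‖(y 0 * v y 0 + y 1 * v y 1) • (EuclideanSpace.single 2 (1 : ℝ) : (EuclideanSpace ℝ (Fin 3))) -
        (y 0 * v y 2) • (EuclideanSpace.single 0 (1 : ℝ) : (EuclideanSpace ℝ (Fin 3))) -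
        (y 1 * v y 2) • (EuclideanSpace.single 1 (1 : ℝ) : (EuclideanSpace ℝ (Fin 3)))‖ ≤ 4 * (‖y‖ * ‖v y‖) := by
  have hy0 : |y 0| ≤ ‖y‖ := by simpa using PiLp.norm_apply_le y 0
  have hy1 : |y 1| ≤ ‖y‖ := by simpa using PiLp.norm_apply_le y 1
  have hv0 : |v y 0| ≤ ‖v y‖ := by simpa using PiLp.norm_apply_le (v y) 0
  have hv1 : |v y 1| ≤ ‖v y‖ := by simpa using PiLp.norm_apply_le (v y) 1
  have hv2 : |v y 2| ≤ ‖v y‖ := by simpa using PiLp.norm_apply_le (v y) 2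
  have hs : ∀ i : Fin 3, ‖(EuclideanSpace.single i (1 : ℝ) : (EuclideanSpace ℝ (Fin 3)))‖ = 1 := fun i => by simp
  have hA : ‖(y 0 * v y 0 + y 1 * v y 1) • (EuclideanSpace.single 2 (1 : ℝ) : (EuclideanSpace ℝ (Fin 3)))‖ ≤
      2 * (‖y‖ * ‖v y‖) := by
    rw [norm_smul, hs, mul_one, Real.norm_eq_abs]
    calc |y 0 * v y 0 + y 1 * v y 1| ≤ |y 0 * v y 0| + |y 1 * v y 1| := abs_add_le _ _
      _ = |y 0| * |v y 0| + |y 1| * |v y 1| := by rw [abs_mul, abs_mul]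
      _ ≤ ‖y‖ * ‖v y‖ + ‖y‖ * ‖v y‖ := by gcongr
      _ = 2 * (‖y‖ * ‖v y‖) := by ring
  have hB : ‖(y 0 * v y 2) • (EuclideanSpace.single 0 (1 : ℝ) : (EuclideanSpace ℝ (Fin 3)))‖ ≤ ‖y‖ * ‖v y‖ := by
    rw [norm_smul, hs, mul_one, Real.norm_eq_abs, abs_mul]; gcongr
  have hC : ‖(y 1 * v y 2) • (EuclideanSpace.single 1 (1 : ℝ) : (EuclideanSpace ℝ (Fin 3)))‖ ≤ ‖y‖ * ‖v y‖ := by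
    rw [norm_smul, hs, mul_one, Real.norm_eq_abs, abs_mul]; gcongr
  calc _ ≤ ‖(y 0 * v y 0 + y 1 * v y 1) • (EuclideanSpace.single 2 (1 : ℝ) : (EuclideanSpace ℝ (Fin 3))) -
        (y 0 * v y 2) • (EuclideanSpace.single 0 (1 : ℝ) : (EuclideanSpace ℝ (Fin 3)))‖ +
        ‖(y 1 * v y 2) • (EuclideanSpace.single 1 (1 : ℝ) : (EuclideanSpace ℝ (Fin 3)))‖ := norm_sub_le _ _
    _ ≤ (‖(y 0 * v y 0 + y 1 * v y 1) • (EuclideanSpace.single 2 (1 : ℝ) : (EuclideanSpace ℝ (Fin 3)))‖ +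
        ‖(y 0 * v y 2) • (EuclideanSpace.single 0 (1 : ℝ) : (EuclideanSpace ℝ (Fin 3)))‖) +
        ‖(y 1 * v y 2) • (EuclideanSpace.single 1 (1 : ℝ) : (EuclideanSpace ℝ (Fin 3)))‖ := by
        gcongr; exact norm_sub_le _ _
    _ ≤ (2 * (‖y‖ * ‖v y‖) + ‖y‖ * ‖v y‖) + ‖y‖ * ‖v y‖ := by gcongr
    _ = 4 * (‖y‖ * ‖v y‖) := by ring

/-- A coordinate of an integrable field is integrable. [folklore] -/
private theorem integrable_apply_coord_vec3 (hint : Integrable v) (i : Fin 3) : Integrable fun x => v x i :=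
  (EuclideanSpace.proj i : (EuclideanSpace ℝ (Fin 3)) →L[ℝ] ℝ).integrable_comp hint

/-- **SAFFMAN'S IMPULSE IDENTITY (3.2.11), axial component, for integrable fields**: for
`v ∈ C¹(ℝ³; ℝ³)` with `v` and the axial impulse density `x ↦ (x × curl v)₃ = swirl (curl v) x`
integrable,
`∫ (x × curl v)₃ dx = 2 ∫ v₃ dx`
— the surface term `∮ x × (n × v) dS` of (3.2.11) dies along large spheres. NO divergence
condition is needed. Proof: `∫ div G = 0` for the flux field `G` of `divergence_axialImpulseFlux_eq`
(`‖G‖ ≤ 4|x|‖v‖`, so `‖G‖/(1+|x|) ∈ L¹`; `div G = (x × curl v)₃ − 2v₃ ∈ L¹`).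
[cite: Saffman1992, §3.2 eq. (3.2.11)] -/
theorem integral_swirl_curl_eq_two_mul_integral (hv : ContDiff ℝ 1 v) (hint : Integrable v)
    (hI : Integrable fun x => swirl (curl v) x) :
    ∫ x, swirl (curl v) x = 2 * ∫ x, v x 2 := by
  set G : (EuclideanSpace ℝ (Fin 3)) → (EuclideanSpace ℝ (Fin 3)) := fun y =>
    (y 0 * v y 0 + y 1 * v y 1) • (EuclideanSpace.single 2 (1 : ℝ) : (EuclideanSpace ℝ (Fin 3))) -
      (y 0 * v y 2) • (EuclideanSpace.single 0 (1 : ℝ) : (EuclideanSpace ℝ (Fin 3))) -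
      (y 1 * v y 2) • (EuclideanSpace.single 1 (1 : ℝ) : (EuclideanSpace ℝ (Fin 3))) with hGdef
  have hcoord : ∀ j : Fin 3, ContDiff ℝ 1 (fun y : (EuclideanSpace ℝ (Fin 3)) => y j) := fun j =>
    (EuclideanSpace.proj j : (EuclideanSpace ℝ (Fin 3)) →L[ℝ] ℝ).contDiff
  have hvc : ∀ i : Fin 3, ContDiff ℝ 1 (fun y => v y i) := fun i => contDiff_apply_coord_vec3 hv i
  have hG1 : ContDiff ℝ 1 G :=
    (((((hcoord 0).mul (hvc 0)).add ((hcoord 1).mul (hvc 1))).smul contDiff_const).sub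
      (((hcoord 0).mul (hvc 2)).smul contDiff_const)).sub (((hcoord 1).mul (hvc 2)).smul contDiff_const)
  have hdivG : (fun x => VectorCalculus.divergence G x) = fun x => swirl (curl v) x - 2 * v x 2 :=
    funext fun x => divergence_axialImpulseFlux_eq ((hv.differentiable one_ne_zero) x)
  have hv2 : Integrable fun x => v x 2 := integrable_apply_coord_vec3 hint 2
  have hdI : Integrable fun x => VectorCalculus.divergence G x := by
    rw [hdivG]; exact hI.sub (hv2.const_mul 2)
  have hwI : Integrable fun x => ‖G x‖ / (1 + ‖x‖) := by
    refine (hint.norm.const_mul 4).mono' ?_ (Eventually.of_forall fun x => ?_)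
    · exact ((hG1.continuous.norm).div (continuous_const.add continuous_norm)
        fun x => (by positivity : (1 : ℝ) + ‖x‖ ≠ 0)).aestronglyMeasurable
    · have h1 : 0 < 1 + ‖x‖ := by positivity
      rw [Real.norm_of_nonneg (by positivity), div_le_iff₀ h1]
      calc ‖G x‖ ≤ 4 * (‖x‖ * ‖v x‖) := norm_axialImpulseFlux_le v x
        _ ≤ 4 * ‖v x‖ * (1 + ‖x‖) := by nlinarith [norm_nonneg x, norm_nonneg (v x)]
  have h := PineauVicol2026.integral_divergence_eq_zero_of_integrable_div hG1 hwI hdI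
  rw [hdivG, integral_sub hI (hv2.const_mul 2), integral_const_mul] at h
  linarith

/-- **The axial impulse of an integrable divergence-free field vanishes** (Saffman (3.2.13) with
(3.2.15): `∫ u = ½∫ x × ω + surface`, and `∫ u = 0`): for `v ∈ C¹(ℝ³; ℝ³)` divergence free with
`v` and `(x × curl v)₃` integrable, `∫ (x × curl v)₃ dx = 0`, i.e. `I₃ = ½ ∫ (x × ω)₃ = 0`.
[cite: Saffman1992, §3.2 eqs. (3.2.13), (3.2.15)] -/
theorem integral_swirl_curl_eq_zero_of_isDivFree (hv : ContDiff ℝ 1 v)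
    (hdiv : VectorCalculus.IsDivFree v) (hint : Integrable v)
    (hI : Integrable fun x => swirl (curl v) x) : ∫ x, swirl (curl v) x = 0 := by
  rw [integral_swirl_curl_eq_two_mul_integral hv hint hI]
  have h := integral_inner_eq_zero_of_isDivFree_of_integrable hv hdiv hint
    (EuclideanSpace.single 2 (1 : ℝ))
  simp only [EuclideanSpace.inner_single_left, map_one, one_mul] at h
  rw [h, mul_zero]

/-- The axial impulse density `(x × curl v)₃ = swirl (curl v)` of a `C¹` field is continuous.
[folklore] -/
private theorem continuous_swirl_curl (hv : ContDiff ℝ 1 v) : Continuous fun x => swirl (curl v) x := by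
  have hc : Continuous (curl v) := continuous_curl hv
  unfold swirl
  fun_prop

/-- **A single-signed axial impulse density of an integrable divergence-free field vanishes
identically**: for `v ∈ C¹(ℝ³; ℝ³)` divergence free and integrable with `(x × curl v)₃` integrable
and `≥ 0` everywhere, `(x × curl v)₃ ≡ 0` (zero integral of a continuous non-negative function).
Equivalently: a field with `(x × curl v)₃ ≥ 0`, `≢ 0` carries the positive impulse `I₃ > 0` and is
NOT integrable (its far field is the dipole `O(|I|/r³)`, Saffman (3.2.7)–(3.2.8)).
[cite: Saffman1992, §3.2 eqs. (3.2.8), (3.2.13)] -/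
theorem swirl_curl_eq_zero_of_nonneg (hv : ContDiff ℝ 1 v) (hdiv : VectorCalculus.IsDivFree v)
    (hint : Integrable v) (hI : Integrable fun x => swirl (curl v) x)
    (hnn : ∀ x, 0 ≤ swirl (curl v) x) (x : (EuclideanSpace ℝ (Fin 3))) : swirl (curl v) x = 0 := by
  have h0 := integral_swirl_curl_eq_zero_of_isDivFree hv hdiv hint hI
  have hae : (fun x => swirl (curl v) x) =ᵐ[volume] 0 :=
    (integral_eq_zero_iff_of_nonneg (fun x => hnn x) hI).1 h0
  have heq : (fun x => swirl (curl v) x) = 0 :=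
    ((continuous_swirl_curl hv).ae_eq_iff_eq volume continuous_const).1 hae
  exact congrFun heq x

end Impulse

/-! ### Axisymmetric dictionary: `(x × ω)₃ = r ω_θ = r² · (ω_θ/r)` -/

section Axisym

variable {v : (EuclideanSpace ℝ (Fin 3)) → (EuclideanSpace ℝ (Fin 3))}

/-- For an axisymmetric `C³` field the axial impulse density is `r² · (ω_θ/r)`:
`(x × curl v)₃ = swirl (curl v) x = cylRadius x ^ 2 * angVortQuot v x` (tree
`IsAxisymmetric.cylRadius_sq_mul_angVortQuot`), as functions (Gallay–Šverák (1.3): `ω = ω_θ e_θ` for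
axisymmetric swirl-free fields; here only axisymmetry is used, `(x × ω)₃ = x₀ω₁ − x₁ω₀ = r ω_θ`).
[cite: GallaySverak2016, §1 (1.3) (arXiv p. 2)] -/
theorem IsAxisymmetric.swirl_curl_eq_cylRadius_sq_mul_angVortQuot (hax : IsAxisymmetric v)
    (hv : ContDiff ℝ 3 v) :
    (fun x => swirl (FluidPDE.curl v) x) = fun x => cylRadius x ^ 2 * angVortQuot v x :=
  funext fun x => (hax.cylRadius_sq_mul_angVortQuot hv x).symm

/-- **The axial impulse `I₃ = ½ ∫ r² (ω_θ/r) dx` of an integrable axisymmetric divergence-free field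
vanishes**: for `v ∈ C³` axisymmetric, divergence free, integrable, with `r²·(ω_θ/r)` integrable,
`∫ r² (ω_θ/r) dx = 0`. (Gallay–Šverák's impulse `𝓘 = ∫ r²ω_θ dr dz` of a swirl-free vortex is, up to
`2π`, this integral; a vortex RING has `𝓘 > 0` and a dipole far field, hence is not integrable.)
[cite: Saffman1992, §3.2 eqs. (3.2.8), (3.2.13)] -/
theorem IsAxisymmetric.integral_cylRadius_sq_mul_angVortQuot_eq_zero (hax : IsAxisymmetric v)
    (hv : ContDiff ℝ 3 v) (hdiv : VectorCalculus.IsDivFree v) (hint : Integrable v)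
    (hI : Integrable fun x => cylRadius x ^ 2 * angVortQuot v x) :
    ∫ x, cylRadius x ^ 2 * angVortQuot v x = 0 := by
  rw [← hax.swirl_curl_eq_cylRadius_sq_mul_angVortQuot hv] at hI ⊢
  exact integral_swirl_curl_eq_zero_of_isDivFree (hv.of_le (by norm_cast)) hdiv hint hI

/-- **SINGLE-SIGNED `ω_θ/r` FORCES `ω_θ ≡ 0` FOR INTEGRABLE FIELDS**: for `v ∈ C³(ℝ³; ℝ³)` axisymmetric,
divergence free and integrable, with `r²·(ω_θ/r)` integrable and `ω_θ/r ≥ 0` everywhere, `ω_θ/r ≡ 0`.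
Off the plane `x₀ = 0` this is `r² > 0` and `swirl_curl_eq_zero_of_nonneg`; on it by continuity
(`eq_of_eq_off_ker`). So a non-trivial single-signed swirl-free vortex (Hill's spherical vortex, a
vortex ring, the smoothed Hill vortices of the tree) is never an integrable field: it carries the
positive impulse `½∫r²(ω_θ/r)` and the `O(|I|/r³)` dipole tail of Saffman (3.2.7)–(3.2.8).
[cite: Saffman1992, §3.2 eqs. (3.2.8), (3.2.13)] -/
theorem IsAxisymmetric.angVortQuot_eq_zero_of_nonneg_of_integrable (hax : IsAxisymmetric v)
    (hv : ContDiff ℝ 3 v) (hdiv : VectorCalculus.IsDivFree v) (hint : Integrable v)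
    (hI : Integrable fun x => cylRadius x ^ 2 * angVortQuot v x) (hη : ∀ x, 0 ≤ angVortQuot v x)
    (x : (EuclideanSpace ℝ (Fin 3))) : angVortQuot v x = 0 := by
  have hid := hax.swirl_curl_eq_cylRadius_sq_mul_angVortQuot hv
  have hI' : Integrable fun x => swirl (FluidPDE.curl v) x := by rw [hid]; exact hI
  have hnn : ∀ y, 0 ≤ swirl (FluidPDE.curl v) y := fun y => by
    rw [← hax.cylRadius_sq_mul_angVortQuot hv y]; exact mul_nonneg (sq_nonneg _) (hη y)
  have hs : ∀ y, swirl (FluidPDE.curl v) y = 0 :=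
    swirl_curl_eq_zero_of_nonneg (hv.of_le (by norm_cast)) hdiv hint hI' hnn
  have hηc : Continuous (angVortQuot v) :=
    (contDiff_angVortQuot (n := 0) (by exact_mod_cast hv)).continuous
  refine eq_of_eq_off_ker (EuclideanSpace.proj (0 : Fin 3) : (EuclideanSpace ℝ (Fin 3)) →L[ℝ] ℝ)
    ⟨EuclideanSpace.single 0 1, by simp⟩ hηc continuous_const (fun z hz => ?_) x
  have hz0 : z 0 ≠ 0 := by simpa using hz
  have hr : cylRadius z ^ 2 ≠ 0 := by
    rw [cylRadius_sq]; nlinarith [sq_nonneg (z 1), sq_pos_of_ne_zero hz0]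
  have h := hax.cylRadius_sq_mul_angVortQuot hv z
  rw [hs z] at h
  exact (mul_eq_zero.1 h).resolve_left hr

/-- **… hence such a field is irrotational**: for `v ∈ C³` axisymmetric AND swirl free, divergence free,
integrable, with `r²·(ω_θ/r)` integrable and `ω_θ/r ≥ 0`, `curl v = 0` (`|ω| = r |ω_θ/r|` for swirl-free
axisymmetric fields, KNSS 2009 §5). [cite: KochNadirashviliSereginSverak2009, §5 p. 9 and Remark 5.1] -/
theorem IsAxisymmetric.curl_eq_zero_of_nonneg_of_integrable (hax : IsAxisymmetric v) (hsw : HasNoSwirl v)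
    (hv : ContDiff ℝ 3 v) (hdiv : VectorCalculus.IsDivFree v) (hint : Integrable v)
    (hI : Integrable fun x => cylRadius x ^ 2 * angVortQuot v x) (hη : ∀ x, 0 ≤ angVortQuot v x) :
    FluidPDE.curl v = 0 := by
  funext x
  have h := norm_curl_eq_cylRadius_mul_abs_angVortQuot hax hsw hv x
  rw [hax.angVortQuot_eq_zero_of_nonneg_of_integrable hv hdiv hint hI hη x, abs_zero, mul_zero] at h
  exact norm_eq_zero.1 h

/-- **… and, if also square integrable, identically zero**: an axisymmetric swirl-free divergence-free
`C³` field on `ℝ³` that is integrable and square integrable, with `r²·(ω_θ/r)` integrable and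
`ω_θ/r ≥ 0` everywhere, is `0` — it is the Biot–Savart velocity of its vorticity (tree
`biotSavart_curl_eq_self_of_integrable_sq`, Majda–Bertozzi Prop. 2.16), which vanishes. In words: the
ONLY integrable finite-energy single-signed swirl-free slice is the trivial one.
[cite: MajdaBertozziCUP2002, §2.4.1 Prop. 2.16] -/
theorem IsAxisymmetric.eq_zero_of_nonneg_of_integrable (hax : IsAxisymmetric v) (hsw : HasNoSwirl v)
    (hv : ContDiff ℝ 3 v) (hdiv : VectorCalculus.IsDivFree v) (hint : Integrable v)
    (h2 : Integrable fun y => ‖v y‖ ^ 2)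
    (hI : Integrable fun x => cylRadius x ^ 2 * angVortQuot v x) (hη : ∀ x, 0 ≤ angVortQuot v x) :
    v = 0 := by
  have hc : FluidPDE.curl v = 0 := hax.curl_eq_zero_of_nonneg_of_integrable hsw hv hdiv hint hI hη
  have h := biotSavart_curl_eq_self_of_integrable_sq (hv.of_le (by norm_cast)) hdiv h2
    (by rw [hc]; simp)
  rw [hc, biotSavart_zero] at h
  exact h.symm

end Axisym

end Literature.Analysis.FluidPDE

end
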